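import Literature.NumberTheory.LFunctions.WeilTwoPrimeDeflM72YDef
import Literature.NumberTheory.LFunctions.WeilTwoPrimeDeflM72YDataPO23
import Literature.NumberTheory.LFunctions.WeilBlockRowsR
import HarnessLib

/-!
# Deflated two-prime certificate M72Y: the materialized odd block agrees with `P_r + Σ μ ĉ ĉᵀ`, rows 110–119

`WeilCert.checkPmRowG` for certificate M72Y (odd block), by `decide +kernel`. Pure proof file; nothing is asserted.
-/

noncomputable section

namespace Literature.NumberTheory.LFunctions

set_option maxHeartbeats 0 in
/-- Row 110 of the materialized odd block is row 110 of `P_r + Σ μ ĉ ĉᵀ` (certificate M72Y). [folklore] -/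
theorem checkPmRowG1_110_weilCertDeflM72Y : weilCertDeflM72YBase.checkPmRowG weilCertDeflM72YP weilCertDeflM72YPmO 1 110 = true := by
  decide +kernel

set_option maxHeartbeats 0 in
/-- Row 111 of the materialized odd block is row 111 of `P_r + Σ μ ĉ ĉᵀ` (certificate M72Y). [folklore] -/
theorem checkPmRowG1_111_weilCertDeflM72Y : weilCertDeflM72YBase.checkPmRowG weilCertDeflM72YP weilCertDeflM72YPmO 1 111 = true := by
  decide +kernel

set_option maxHeartbeats 0 in
/-- Row 112 of the materialized odd block is row 112 of `P_r + Σ μ ĉ ĉᵀ` (certificate M72Y). [folklore] -/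
theorem checkPmRowG1_112_weilCertDeflM72Y : weilCertDeflM72YBase.checkPmRowG weilCertDeflM72YP weilCertDeflM72YPmO 1 112 = true := by
  decide +kernel

set_option maxHeartbeats 0 in
/-- Row 113 of the materialized odd block is row 113 of `P_r + Σ μ ĉ ĉᵀ` (certificate M72Y). [folklore] -/
theorem checkPmRowG1_113_weilCertDeflM72Y : weilCertDeflM72YBase.checkPmRowG weilCertDeflM72YP weilCertDeflM72YPmO 1 113 = true := by
  decide +kernel

set_option maxHeartbeats 0 in
/-- Row 114 of the materialized odd block is row 114 of `P_r + Σ μ ĉ ĉᵀ` (certificate M72Y). [folklore] -/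
theorem checkPmRowG1_114_weilCertDeflM72Y : weilCertDeflM72YBase.checkPmRowG weilCertDeflM72YP weilCertDeflM72YPmO 1 114 = true := by
  decide +kernel

set_option maxHeartbeats 0 in
/-- Row 115 of the materialized odd block is row 115 of `P_r + Σ μ ĉ ĉᵀ` (certificate M72Y). [folklore] -/
theorem checkPmRowG1_115_weilCertDeflM72Y : weilCertDeflM72YBase.checkPmRowG weilCertDeflM72YP weilCertDeflM72YPmO 1 115 = true := by
  decide +kernel

set_option maxHeartbeats 0 in
/-- Row 116 of the materialized odd block is row 116 of `P_r + Σ μ ĉ ĉᵀ` (certificate M72Y). [folklore] -/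
theorem checkPmRowG1_116_weilCertDeflM72Y : weilCertDeflM72YBase.checkPmRowG weilCertDeflM72YP weilCertDeflM72YPmO 1 116 = true := by
  decide +kernel

set_option maxHeartbeats 0 in
/-- Row 117 of the materialized odd block is row 117 of `P_r + Σ μ ĉ ĉᵀ` (certificate M72Y). [folklore] -/
theorem checkPmRowG1_117_weilCertDeflM72Y : weilCertDeflM72YBase.checkPmRowG weilCertDeflM72YP weilCertDeflM72YPmO 1 117 = true := by
  decide +kernel

set_option maxHeartbeats 0 in
/-- Row 118 of the materialized odd block is row 118 of `P_r + Σ μ ĉ ĉᵀ` (certificate M72Y). [folklore] -/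
theorem checkPmRowG1_118_weilCertDeflM72Y : weilCertDeflM72YBase.checkPmRowG weilCertDeflM72YP weilCertDeflM72YPmO 1 118 = true := by
  decide +kernel

set_option maxHeartbeats 0 in
/-- Row 119 of the materialized odd block is row 119 of `P_r + Σ μ ĉ ĉᵀ` (certificate M72Y). [folklore] -/
theorem checkPmRowG1_119_weilCertDeflM72Y : weilCertDeflM72YBase.checkPmRowG weilCertDeflM72YP weilCertDeflM72YPmO 1 119 = true := by
  decide +kernel


end Literature.NumberTheory.LFunctions
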